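import Literature.Analysis.Complex.HadamardDivision
import Literature.Analysis.Complex.OsgoodProofs
import Mathlib.Analysis.Calculus.InverseFunctionTheorem.ContDiff
import Mathlib.Analysis.Calculus.FDeriv.Bilinear
import Mathlib.Analysis.Calculus.FDeriv.Symmetric
import Mathlib.Analysis.Normed.Operator.Bilinear
import Mathlib.Analysis.Normed.Ring.Units
import Mathlib.LinearAlgebra.QuadraticForm.AlgClosed
import Mathlib.Topology.Algebra.Module.FiniteDimension
import Mathlib.Topology.OpenPartialHomeomorph.Composition
import Mathlib.Topology.OpenPartialHomeomorph.Constructions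
import Mathlib.Analysis.Complex.Polynomial.Basic
import HarnessLib

/-!
# The holomorphic Morse lemma

Layer `Literature/Geometry/ComplexAnalytic` (next to `CyclicNodePencilMorseChart`, the EXPLICIT Morse chart of the cyclic
node used by the crux K1 of `Summits/HodgeConjecture/HodgeConjecture/Theses/CyclicUnitaryPowers.lean`).  Written by the
prover seat `hodge-nonav-prover-Bx` (g12, cell `hodge-nonav`) as the general-position input of the Picard–Lefschetz
programme of the routes `CyclicUnitaryPowers` / `SignSymmetricPowers` (binders hPL `picardLefschetz_nodalForms_uniform`,
hB2 `picardLefschetz_symmetricA3` of crux K1-B, stmt-HodgeConjecture-19716): at an ordinary double point of an ARBITRARY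
hypersurface the local equation must be brought to the Brieskorn–Pham normal form `z₁² + ⋯ + z_m²` by a holomorphic
change of coordinates before the local model (`PhamBrieskornCyclicNode*` with all exponents `2`) applies.

**Theorem (holomorphic Morse lemma; Milnor, *Morse theory* (1963), Lemma 2.2, whose proof is holomorphic verbatim;
Arnold–Gusein-Zade–Varchenko, *Singularities of Differentiable Maps* I, §6.1 (the complex Morse lemma); Ebeling,
*Functions of Several Complex Variables and Their Singularities*, Prop. 3.12).**  *Let `f` be holomorphic near a point `p`
of `ℂᵐ` with `df(p) = 0` and non-degenerate Hessian `d²f(p)`.  Then there are holomorphic coordinates `z = Θ(x)` centred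
at `p` with `f(x) = f(p) + z₁² + ⋯ + z_m²`.*

Rendering: `Literature.Geometry.ComplexAnalytic.exists_holomorphicMorseChart` — for `f : (Fin m → ℂ) → ℂ` complex
differentiable on an open `U ∋ p`, with `fderiv ℂ f p = 0` and `HasFDerivAt (fderiv ℂ f) L p` for a non-degenerate `L`
(`∀ u, (∀ v, L u v = 0) → u = 0`), there is an `OpenPartialHomeomorph Θ` of `Fin m → ℂ` with `p ∈ Θ.source ⊆ U`,
`Θ p = 0`, `Θ` complex differentiable and real `C^∞` on its source, `Θ.symm` real `C^∞` on its target, and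
`f x = f p + Σᵢ (Θ x)ᵢ²` on `Θ.source` — the output format of `PhamBrieskorn.exists_cyclicNodePencil_morseChart`.

**Proof** (Hirsch's route, *Differential Topology* Ch. 6 §1, as in the tree's REAL Morse lemma
`Literature/Topology/FourManifolds/MorseLemma.lean`, ported to `ℂ`; no Sylvester step since over `ℂ` every
non-degenerate quadratic form is a sum of squares).  §0 packages Mathlib's inverse function theorem over `ℂ`.
§1 ports Hirsch's parametric diagonalization: for a symmetric non-degenerate `H₀ : V →L[ℂ] V →L[ℂ] ℂ` there is `P`,
holomorphic near `H₀` in the space of bilinear forms, with `P H₀ = 1` and `H₀ (P B u) (P B v) = B u v` for symmetric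
`B` near `H₀` (inverse function theorem applied to `C ↦ H₀ + C + H₀(T C ·, T C ·)`, `T C = ½ H₀⁻¹ C`).  §2 is the
holomorphic Hadamard lemma of second order on the polydisc `‖x‖ < r` of `Fin m → ℂ`: `f x = R_x(x, x)` with
`x ↦ R_x` holomorphic, `R_x` symmetric and `R_0 = ½ L` (two applications of the tree's holomorphic Hadamard division
`Literature.Analysis.Complex.SCV.exists_eq_add_sum_smul`; the identification of `R_0` through second derivatives along
the complex lines `t ↦ t(eᵢ + eⱼ)`).  §3: `θ x := P(R_x) x` has `dθ(0) = 1` and `f = H₀(θ ·, θ ·)`; composing with a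
linear isometry `H₀ ≅ Σ zᵢ²` (Mathlib's `QuadraticForm.equivalent_of_isAlgClosed`) gives the chart.  §4: translation to
a general centre `p`.

## References

* [Milnor1963] J. Milnor, *Morse theory*, Ann. of Math. Studies 51 (1963), Lemma 2.2.
* [ArnoldGuseinZadeVarchenko1985] V. I. Arnold, S. M. Gusein-Zade, A. N. Varchenko, *Singularities of Differentiable
  Maps*, Vol. I, Birkhäuser (1985), §6.1 (the complex Morse lemma), §11.1.
* [HirschDT1976] M. W. Hirsch, *Differential Topology*, GTM 33 (1976), Ch. 6 §1, Thm. 1.1 and the Lemma on p. 145.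
* [Ebeling2007] W. Ebeling, *Functions of Several Complex Variables and Their Singularities*, GSM 83 (2007), Prop. 3.12.
-/

noncomputable section

open Set Function Filter Module Metric
open scoped Topology ContDiff

-- Instance search through the tower `V →L[ℂ] V →L[ℂ] ℂ` needs one more level of pending depth,
-- as in Mathlib's operator-norm files.
set_option maxSynthPendingDepth 2

namespace Literature.Geometry.ComplexAnalytic

namespace HolomorphicMorse

/-! ### §0 The inverse function theorem over `ℂ`, packaged -/

/-- **Inverse function theorem, packaged over `ℂ`**: a map `Cᵐ` over `ℂ` (`m ≥ 1`) on an open `O ∋ y₀` of a complete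
complex normed space with invertible derivative at `y₀` restricts to an open partial homeomorphism `G = Θ` with
`y₀ ∈ G.source ⊆ O`, `Cᵐ` with `Cᵐ` inverse on the whole target (restrict to where the derivative stays invertible;
the real version is the tree's `Topology.FourManifolds.exists_openPartialHomeomorph_contDiffOn_symm`; the inverse function
theorem, Lee Thm. 4.5 / Hirsch Ch. 6 §1, in Mathlib's `ContDiffAt.toOpenPartialHomeomorph` form over `𝕂 = ℂ`).
[cite: LeeSmoothManifolds2013, Thm. 4.5 (inverse function theorem)] -/
theorem exists_openPartialHomeomorph_contDiffOn_symm {E F : Type*} [NormedAddCommGroup E]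
    [NormedSpace ℂ E] [CompleteSpace E] [NormedAddCommGroup F] [NormedSpace ℂ F]
    {Θ : E → F} {O : Set E} (hO : IsOpen O) {y₀ : E} (hy₀ : y₀ ∈ O) {m : WithTop ℕ∞}
    (hm : 1 ≤ m) (hΘ : ContDiffOn ℂ m Θ O) (T : E ≃L[ℂ] F)
    (hT : HasFDerivAt Θ (T : E →L[ℂ] F) y₀) :
    ∃ G : OpenPartialHomeomorph E F, ⇑G = Θ ∧ y₀ ∈ G.source ∧ G.source ⊆ O ∧
      ContDiffOn ℂ m G G.source ∧ ContDiffOn ℂ m G.symm G.target ∧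
      ∀ e ∈ G.source, ∃ Te : E ≃L[ℂ] F, HasFDerivAt Θ (Te : E →L[ℂ] F) e := by
  have hm0 : m ≠ 0 := by
    rintro rfl
    exact not_lt.2 hm zero_lt_one
  -- the open subset `O' ⊆ O` where the derivative of `Θ` is invertible
  set A : E → E →L[ℂ] E := fun e => (T.symm : F →L[ℂ] E).comp (fderiv ℂ Θ e) with hA
  have hAcont : ContinuousOn A O :=
    continuousOn_const.clm_comp (hΘ.continuousOn_fderiv_of_isOpen hO hm)
  set O' : Set E := O ∩ A ⁻¹' {u | IsUnit u} with hO'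
  have hO'open : IsOpen O' := hAcont.isOpen_inter_preimage hO Units.isOpen
  have hAy : A y₀ = 1 := by
    rw [hA]
    dsimp only
    rw [hT.fderiv]
    ext v
    simp
  have hyO' : y₀ ∈ O' := ⟨hy₀, by rw [mem_preimage, mem_setOf_eq, hAy]; exact isUnit_one⟩
  have hΘAt : ∀ e ∈ O', ContDiffAt ℂ m Θ e := fun e he => hΘ.contDiffAt (hO.mem_nhds he.1)
  have hderiv : ∀ e ∈ O', ∃ Te : E ≃L[ℂ] F, HasFDerivAt Θ (Te : E →L[ℂ] F) e := by
    intro e he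
    have hunit : IsUnit (A e) := he.2
    refine ⟨(ContinuousLinearEquiv.unitsEquiv ℂ E hunit.unit).trans T, ?_⟩
    have hd : HasFDerivAt Θ (fderiv ℂ Θ e) e := ((hΘAt e he).differentiableAt hm0).hasFDerivAt
    convert hd using 1
    ext v
    simp [hA]
  set G : OpenPartialHomeomorph E F :=
    ((hΘAt _ hyO').toOpenPartialHomeomorph Θ hT hm0).restrOpen O' hO'open with hGdef
  have hGsource : G.source ⊆ O' := fun e he => he.2
  refine ⟨G, rfl, ⟨(hΘAt _ hyO').mem_toOpenPartialHomeomorph_source hT hm0, hyO'⟩,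
    fun e he => (hGsource he).1, hΘ.mono fun e he => (hGsource he).1, ?_, fun e he => hderiv e (hGsource he)⟩
  intro b hb
  have hb' : G.symm b ∈ O' := hGsource (G.map_target hb)
  obtain ⟨Te, hTe⟩ := hderiv _ hb'
  exact (G.contDiffAt_symm hb hTe (hΘAt _ hb')).contDiffWithinAt

/-! ### §1 Hirsch's parametric diagonalization lemma over `ℂ` -/

section Diagonalization

variable {V : Type*} [NormedAddCommGroup V] [NormedSpace ℂ V]

/-- `(S₁, S₂) ↦ H₀ (S₁ ·) (S₂ ·)` (`ContinuousLinearMap.bilinearComp`) is a bounded bilinear map of the pair of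
endomorphisms, for a fixed continuous bilinear form `H₀` (complex version of the tree's
`Topology.FourManifolds.isBoundedBilinearMap_bilinearComp`). [folklore] -/
private theorem isBoundedBilinearMap_bilinearComp (H₀ : V →L[ℂ] V →L[ℂ] ℂ) :
    IsBoundedBilinearMap ℂ
      (fun p : (V →L[ℂ] V) × (V →L[ℂ] V) => H₀.bilinearComp p.1 p.2) where
  add_left S₁ S₂ S := by
    ext u v
    simp [ContinuousLinearMap.bilinearComp_apply]
  smul_left c S S' := by
    ext u v
    simp [ContinuousLinearMap.bilinearComp_apply]
  add_right S S₁ S₂ := by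
    ext u v
    simp [ContinuousLinearMap.bilinearComp_apply]
  smul_right c S S' := by
    ext u v
    simp [ContinuousLinearMap.bilinearComp_apply]
  bound := by
    refine ⟨‖H₀‖ + 1, by positivity, fun S₁ S₂ => ?_⟩
    refine ContinuousLinearMap.opNorm_le_bound _ (by positivity) fun u => ?_
    refine ContinuousLinearMap.opNorm_le_bound _ (by positivity) fun v => ?_
    rw [ContinuousLinearMap.bilinearComp_apply]
    calc ‖H₀ (S₁ u) (S₂ v)‖ ≤ ‖H₀ (S₁ u)‖ * ‖S₂ v‖ := ContinuousLinearMap.le_opNorm _ _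
      _ ≤ ‖H₀‖ * ‖S₁ u‖ * (‖S₂‖ * ‖v‖) := by
        gcongr
        · exact ContinuousLinearMap.le_opNorm _ _
        · exact ContinuousLinearMap.le_opNorm _ _
      _ ≤ (‖H₀‖ + 1) * (‖S₁‖ * ‖u‖) * (‖S₂‖ * ‖v‖) := by
        gcongr
        · linarith [norm_nonneg H₀]
        · exact ContinuousLinearMap.le_opNorm _ _
      _ = (‖H₀‖ + 1) * ‖S₁‖ * ‖S₂‖ * ‖u‖ * ‖v‖ := by ring

variable [FiniteDimensional ℂ V]

/-- A nondegenerate continuous bilinear form on a finite-dimensional complex space, viewed as a map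
`V → (V →L[ℂ] ℂ)`, is a linear isomorphism. [folklore] -/
private theorem exists_continuousLinearEquiv_eq_of_nondegenerate (H₀ : V →L[ℂ] V →L[ℂ] ℂ)
    (hH : ∀ u, (∀ v, H₀ u v = 0) → u = 0) :
    ∃ e : V ≃L[ℂ] (V →L[ℂ] ℂ), ∀ u, e u = H₀ u := by
  have hinj : Injective (H₀ : V →ₗ[ℂ] (V →L[ℂ] ℂ)) := by
    rw [← LinearMap.ker_eq_bot, LinearMap.ker_eq_bot']
    intro u hu
    exact hH u fun v => by rw [show H₀ u = 0 from hu]; rfl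
  have hdim : finrank ℂ V = finrank ℂ (V →L[ℂ] ℂ) := by
    rw [← LinearEquiv.finrank_eq (LinearMap.toContinuousLinearMap : (V →ₗ[ℂ] ℂ) ≃ₗ[ℂ] V →L[ℂ] ℂ),
      Module.finrank_linearMap_self]
  exact ⟨(LinearMap.linearEquivOfInjective _ hinj hdim).toContinuousLinearEquiv, fun u => rfl⟩

/-- **Hirsch's parametric diagonalization lemma over `ℂ`** (transposed, coordinate-free, holomorphic form).  Let `H₀`
be a symmetric nondegenerate continuous bilinear form on a finite-dimensional complex normed space `V`.  Then there
are an open neighbourhood `N` of `H₀` in `V →L[ℂ] V →L[ℂ] ℂ` and a map `P` into `V →L[ℂ] V`, complex `C^∞` on `N`,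
with `P H₀ = 1` and `H₀ (P B u) (P B v) = B u v` for all symmetric `B ∈ N` (Hirsch, *Differential Topology* Ch. 6 §1,
Lemma p. 145, "`ᵗQ B Q = A`", there real and by induction; here by the inverse function theorem applied to
`C ↦ H₀ + C + H₀(T C ·, T C ·)`, `T C = ½ H₀⁻¹ C`, exactly as the tree's real
`Topology.FourManifolds.exists_contDiffOn_bilinearComp_eq`). [cite: HirschDT1976, Ch. 6 §1, Lemma (p. 145)] -/
theorem exists_contDiffOn_bilinearComp_eq (H₀ : V →L[ℂ] V →L[ℂ] ℂ) (hsymm : ∀ u v, H₀ u v = H₀ v u)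
    (hH : ∀ u, (∀ v, H₀ u v = 0) → u = 0) :
    ∃ (N : Set (V →L[ℂ] V →L[ℂ] ℂ)) (P : (V →L[ℂ] V →L[ℂ] ℂ) → (V →L[ℂ] V)),
      IsOpen N ∧ H₀ ∈ N ∧ ContDiffOn ℂ ∞ P N ∧ P H₀ = 1 ∧
      ∀ B ∈ N, (∀ u v, B u v = B v u) → ∀ u v, H₀ (P B u) (P B v) = B u v := by
  -- `H₀` as an isomorphism `V ≅ V →L ℂ`, and `T C = ½ H₀⁻¹ ∘ C`
  obtain ⟨e, he⟩ := exists_continuousLinearEquiv_eq_of_nondegenerate H₀ hH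
  set T : (V →L[ℂ] V →L[ℂ] ℂ) →L[ℂ] (V →L[ℂ] V) :=
    (2⁻¹ : ℂ) • ContinuousLinearMap.compL ℂ V (V →L[ℂ] ℂ) V (e.symm : (V →L[ℂ] ℂ) →L[ℂ] V)
    with hT
  have hTapply : ∀ C u v, H₀ (T C u) v = 2⁻¹ * C u v := by
    intro C u v
    have h1 : T C u = (2⁻¹ : ℂ) • e.symm (C u) := by
      simp [hT, ContinuousLinearMap.compL_apply]
    rw [h1, map_smul, FunLike.coe_smul, Pi.smul_apply, ← he, e.apply_symm_apply, smul_eq_mul]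
  have hTapply' : ∀ C u v, H₀ u (T C v) = 2⁻¹ * C v u := by
    intro C u v
    rw [hsymm, hTapply]
  -- the polynomial map `Ψ`
  set β : (V →L[ℂ] V) × (V →L[ℂ] V) → (V →L[ℂ] V →L[ℂ] ℂ) :=
    fun p => H₀.bilinearComp p.1 p.2 with hβ
  have hβb : IsBoundedBilinearMap ℂ β := isBoundedBilinearMap_bilinearComp H₀
  set Ψ : (V →L[ℂ] V →L[ℂ] ℂ) → (V →L[ℂ] V →L[ℂ] ℂ) := fun C => H₀ + C + β (T C, T C) with hΨ
  have hΨapply : ∀ C u v, Ψ C u v = H₀ u v + C u v + H₀ (T C u) (T C v) := by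
    intro C u v
    simp [hΨ, hβ, ContinuousLinearMap.bilinearComp_apply]
  have hΨ0 : Ψ 0 = H₀ := by
    ext u v
    simp [hΨapply]
  have hΨsmooth : ContDiff ℂ ∞ Ψ :=
    (contDiff_const.add contDiff_id).add (hβb.contDiff.comp (T.contDiff.prodMk T.contDiff))
  -- its derivative at `0` is the identity
  have hΨderiv : HasFDerivAt Ψ ((ContinuousLinearEquiv.refl ℂ (V →L[ℂ] V →L[ℂ] ℂ) :
      (V →L[ℂ] V →L[ℂ] ℂ) ≃L[ℂ] (V →L[ℂ] V →L[ℂ] ℂ)) :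
        (V →L[ℂ] V →L[ℂ] ℂ) →L[ℂ] (V →L[ℂ] V →L[ℂ] ℂ)) 0 := by
    have h1 : HasFDerivAt (fun C => β (T C, T C)) ((hβb.deriv (T 0, T 0)).comp
        ((T : (V →L[ℂ] V →L[ℂ] ℂ) →L[ℂ] (V →L[ℂ] V)).prod
          (T : (V →L[ℂ] V →L[ℂ] ℂ) →L[ℂ] (V →L[ℂ] V)))) 0 := by
      show HasFDerivAt (β ∘ fun C => (T C, T C)) _ 0
      exact (hβb.hasFDerivAt (T 0, T 0)).comp 0 (T.hasFDerivAt.prodMk T.hasFDerivAt)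
    have h3 := ((hasFDerivAt_const H₀ (0 : V →L[ℂ] V →L[ℂ] ℂ)).add (hasFDerivAt_id 0)).add h1
    refine h3.congr_fderiv ?_
    ext C u v
    simp [hβb.deriv_apply, hβ]
  -- inverse function theorem, with smooth inverse on the whole target
  obtain ⟨G, hGΨ, h0G, -, -, hGsymm, -⟩ :=
    exists_openPartialHomeomorph_contDiffOn_symm isOpen_univ (mem_univ 0) (m := ∞) (by simp)
      hΨsmooth.contDiffOn (ContinuousLinearEquiv.refl ℂ _) hΨderiv
  refine ⟨G.target, fun B => 1 + T (G.symm B), G.open_target, ?_, ?_, ?_, ?_⟩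
  · -- `H₀ = Ψ 0 ∈ target`
    rw [← hΨ0, ← hGΨ]
    exact G.map_source h0G
  · -- smoothness
    exact contDiffOn_const.add (T.contDiff.comp_contDiffOn hGsymm)
  · -- `P H₀ = 1`
    have h : G.symm H₀ = 0 := by
      rw [← hΨ0, ← hGΨ]
      exact G.left_inv h0G
    show 1 + T (G.symm H₀) = 1
    rw [h, map_zero, add_zero]
  · -- the identity for symmetric `B`
    intro B hB hBsymm u v
    set C := G.symm B with hC
    have hΨC : Ψ C = B := by rw [← hGΨ, hC, G.right_inv hB]
    -- `C` is symmetric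
    have hCsymm : ∀ u v, C u v = C v u := by
      intro u v
      have h1 := congrArg (fun D : V →L[ℂ] V →L[ℂ] ℂ => D u v - D v u) hΨC
      simp only [hΨapply] at h1
      rw [hBsymm u v, sub_self, hsymm (T C u) (T C v), hsymm u v] at h1
      linear_combination h1
    -- expand
    show H₀ (u + T C u) (v + T C v) = B u v
    calc H₀ (u + T C u) (v + T C v)
        = H₀ u v + H₀ (T C u) v + H₀ u (T C v) + H₀ (T C u) (T C v) := by
          simp only [map_add, add_apply]
          ring
      _ = H₀ u v + C u v + H₀ (T C u) (T C v) := by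
          rw [hTapply, hTapply', hCsymm v u]
          ring
      _ = Ψ C u v := (hΨapply C u v).symm
      _ = B u v := by rw [hΨC]

end Diagonalization


/-! ### §2 The holomorphic Hadamard lemma of second order on the polydisc of `Fin m → ℂ` -/

section Hadamard

variable {m : ℕ}

/-- The coordinate bilinear forms `(u, v) ↦ uᵢ vⱼ` on `Fin m → ℂ`. [folklore] -/
private theorem coordForm_apply (i j : Fin m) (u v : Fin m → ℂ) :
    ((ContinuousLinearMap.proj (R := ℂ) (φ := fun _ : Fin m => ℂ) i).smulRight
      (ContinuousLinearMap.proj (R := ℂ) (φ := fun _ : Fin m => ℂ) j)) u v = u i * v j := by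
  simp [ContinuousLinearMap.smulRight_apply]

/-- The sup-norm ball of `Fin m → ℂ` is the product domain of the coordinate projections used by the tree's
holomorphic Hadamard division. [folklore] -/
private theorem setOf_proj_mem_ball_eq {r : ℝ} (hr : 0 < r) :
    {z : Fin m → ℂ | ∀ i, (ContinuousLinearMap.proj (R := ℂ) (φ := fun _ : Fin m => ℂ) i) (z - 0) ∈
      ball (0 : ℂ) r} = ball (0 : Fin m → ℂ) r := by
  ext z
  simp only [mem_setOf_eq, sub_zero, ContinuousLinearMap.proj_apply, mem_ball, dist_zero_right]
  exact (pi_norm_lt_iff hr).symm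

/-- **Holomorphic Hadamard lemma of second order** (Milnor, *Morse theory*, Lemma 2.1 applied twice, holomorphic
version via the tree's `SCV.exists_eq_add_sum_smul`): a function holomorphic on the polydisc `‖z‖ < r` of `Fin m → ℂ`
with `f 0 = 0` and `df(0) = 0` writes `f z = Σᵢⱼ zᵢ zⱼ hᵢⱼ(z)` with `hᵢⱼ` holomorphic on the polydisc.
[cite: Milnor1963, Lemma 2.1 and proof of Lemma 2.2] -/
theorem exists_eq_sum_mul_mul {r : ℝ} (hr : 0 < r) {f : (Fin m → ℂ) → ℂ} (hf : DifferentiableOn ℂ f (ball 0 r))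
    (h0 : f 0 = 0) (h1 : fderiv ℂ f 0 = 0) :
    ∃ h : Fin m → Fin m → (Fin m → ℂ) → ℂ, (∀ i j, DifferentiableOn ℂ (h i j) (ball 0 r)) ∧
      ∀ z ∈ ball (0 : Fin m → ℂ) r, f z = ∑ i, ∑ j, z i * z j * h i j z := by
  classical
  -- the biorthogonal system of coordinates
  set e : Fin m → (Fin m → ℂ) := fun i => Pi.single i 1 with he
  set ℓ : Fin m → (Fin m → ℂ) →L[ℂ] ℂ := fun i => ContinuousLinearMap.proj i with hℓ
  have hdual : ∀ i j, ℓ i (e j) = if i = j then 1 else 0 := by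
    intro i j
    simp only [hℓ, he, ContinuousLinearMap.proj_apply, Pi.single_apply]
  have hspan : ∀ z : Fin m → ℂ, ∑ i, ℓ i z • e i = z := by
    intro z
    funext k
    simp only [hℓ, he, Finset.sum_apply, Pi.smul_apply, ContinuousLinearMap.proj_apply, Pi.single_apply, smul_eq_mul,
      mul_ite, mul_one, mul_zero]
    rw [Finset.sum_ite_eq]
    simp
  have hP := setOf_proj_mem_ball_eq (m := m) hr
  have hD : ∀ _i : Fin m, IsOpen (ball (0 : ℂ) r) := fun _ => isOpen_ball
  have hD0 : ∀ _i : Fin m, (0 : ℂ) ∈ ball (0 : ℂ) r := fun _ => mem_ball_self hr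
  -- first division
  have hf' : DifferentiableOn ℂ f {z : Fin m → ℂ | ∀ i, ℓ i (z - 0) ∈ ball (0 : ℂ) r} := by rwa [hP]
  obtain ⟨g, hg, hfg⟩ := Literature.Analysis.Complex.SCV.exists_eq_sum_smul_of_apply_eq_zero e ℓ hdual hspan 0
    (fun _ => ball (0 : ℂ) r) hD hD0 hf' h0
  rw [hP] at hg hfg
  -- second division, for each `gᵢ`
  have hg2 := fun i => Literature.Analysis.Complex.SCV.exists_eq_add_sum_smul e ℓ hdual hspan 0
    (fun _ => ball (0 : ℂ) r) hD hD0 (f := g i) (by rw [hP]; exact hg i)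
  choose h hh' hgh' using hg2
  have hh : ∀ i j, DifferentiableOn ℂ (h i j) (ball 0 r) := fun i j =>
    (hh' i j).mono fun z hz => (Set.ext_iff.1 hP z).2 hz
  have hgh : ∀ i, ∀ z ∈ ball (0 : Fin m → ℂ) r, g i z = g i 0 + ∑ j, ℓ j (z - 0) • h i j z :=
    fun i z hz => hgh' i z ((Set.ext_iff.1 hP z).2 hz)
  -- `gᵢ(0) = 0` from `df(0) = 0`
  have hg0 : ∀ i, g i 0 = 0 := by
    intro i
    have hball : ball (0 : Fin m → ℂ) r ∈ 𝓝 (0 : Fin m → ℂ) := isOpen_ball.mem_nhds (mem_ball_self hr)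
    have hderiv : HasFDerivAt (fun z : Fin m → ℂ => ∑ k, ℓ k (z - 0) • g k z) (∑ k, g k 0 • ℓ k) 0 := by
      have hsum : HasFDerivAt (fun z : Fin m → ℂ => ∑ k, z k * g k z)
          (∑ k, ((0 : Fin m → ℂ) k • fderiv ℂ (g k) 0 + g k 0 • ℓ k)) 0 := by
        refine HasFDerivAt.fun_sum fun k _ => ?_
        have hgk : HasFDerivAt (g k) (fderiv ℂ (g k) 0) 0 :=
          ((hg k).differentiableAt hball).hasFDerivAt
        exact (hasFDerivAt_apply k (0 : Fin m → ℂ)).mul hgk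
      have e1 : (fun z : Fin m → ℂ => ∑ k, ℓ k (z - 0) • g k z) = fun z => ∑ k, z k * g k z := by
        funext z; simp [hℓ]
      rw [e1]
      refine hsum.congr_fderiv ?_
      simp
    have hfd : HasFDerivAt f (∑ k, g k 0 • ℓ k) 0 := by
      refine hderiv.congr_of_eventuallyEq ?_
      filter_upwards [hball] with z hz
      exact hfg z hz
    have hzero : (∑ k, g k 0 • ℓ k) = 0 := by rw [← hfd.fderiv, h1]
    have h2 := congrArg (fun T : (Fin m → ℂ) →L[ℂ] ℂ => T (e i)) hzero
    simp only [FunLike.coe_sum, Finset.sum_apply, FunLike.coe_smul, Pi.smul_apply, hdual, smul_eq_mul, mul_ite,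
      mul_one, mul_zero, Finset.sum_ite_eq', Finset.mem_univ, if_true, zero_apply] at h2
    exact h2
  refine ⟨h, hh, fun z hz => ?_⟩
  rw [hfg z hz]
  refine Finset.sum_congr rfl fun i _ => ?_
  rw [hgh i z hz, hg0 i, zero_add, Finset.smul_sum]
  refine Finset.sum_congr rfl fun j _ => ?_
  simp only [hℓ, ContinuousLinearMap.proj_apply, sub_zero, smul_eq_mul]
  ring

/-- **The second derivative along a complex line.**  If `f` is holomorphic on the polydisc `‖z‖ < r`, `df(0) = 0`,
`d(df)(0) = L`, and along the line `t ↦ t • w` one has `f (t • w) = t² q(t)` near `t = 0` with `q` holomorphic, then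
`L w w = 2 q(0)`. [folklore] -/
private theorem apply_apply_eq_two_mul {r : ℝ} {f : (Fin m → ℂ) → ℂ}
    (hf : DifferentiableOn ℂ f (ball 0 r)) (h1 : fderiv ℂ f 0 = 0) {L : (Fin m → ℂ) →L[ℂ] (Fin m → ℂ) →L[ℂ] ℂ}
    (h2 : HasFDerivAt (fderiv ℂ f) L 0) (w : Fin m → ℂ) {δ : ℝ} (hδ : 0 < δ)
    (hδr : ∀ t : ℂ, ‖t‖ < δ → t • w ∈ ball (0 : Fin m → ℂ) r) {q : ℂ → ℂ}
    (hq : DifferentiableOn ℂ q (ball 0 δ)) (hfq : ∀ t : ℂ, ‖t‖ < δ → f (t • w) = t ^ 2 * q t) :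
    L w w = 2 * q 0 := by
  -- `φ t = df(t w) w` has derivative `L w w` at `0`
  set φ : ℂ → ℂ := fun t => (fderiv ℂ f (t • w)) w with hφ
  have hline : ∀ t : ℂ, HasDerivAt (fun t : ℂ => t • w) w t := fun t => by
    simpa using (hasDerivAt_id t).smul_const w
  have hφ' : HasDerivAt φ (L w w) 0 := by
    have hk : HasDerivAt (fun t : ℂ => fderiv ℂ f (t • w)) (L w) 0 := by
      have h2' : HasFDerivAt (fderiv ℂ f) L ((0 : ℂ) • w) := by rwa [zero_smul]
      exact h2'.comp_hasDerivAt 0 (hline 0)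
    have h := hk.clm_apply (hasDerivAt_const (0 : ℂ) w)
    simpa using h
  have hφ0 : φ 0 = 0 := by simp [hφ, h1]
  -- `F t = f (t w) = t² q t`: its derivative is `φ t` and also `2 t q t + t² q' t`
  have hqa : AnalyticOnNhd ℂ q (ball 0 δ) := hq.analyticOnNhd isOpen_ball
  have hφeq : ∀ t : ℂ, ‖t‖ < δ → φ t = 2 * t * q t + t ^ 2 * deriv q t := by
    intro t ht
    have htball : t ∈ ball (0 : ℂ) δ := by rwa [mem_ball, dist_zero_right]
    have hF1 : HasDerivAt (fun t : ℂ => f (t • w)) (φ t) t := by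
      have hfd : HasFDerivAt f (fderiv ℂ f (t • w)) (t • w) :=
        (hf.differentiableAt (isOpen_ball.mem_nhds (hδr t ht))).hasFDerivAt
      exact hfd.comp_hasDerivAt t (hline t)
    have hq' : HasDerivAt q (deriv q t) t := (hq.differentiableAt (isOpen_ball.mem_nhds htball)).hasDerivAt
    have hF2 : HasDerivAt (fun t : ℂ => t * t * q t) ((1 * t + t * 1) * q t + t * t * deriv q t) t :=
      ((hasDerivAt_id t).mul (hasDerivAt_id t)).mul hq'
    have hF2' : HasDerivAt (fun t : ℂ => f (t • w)) ((1 * t + t * 1) * q t + t * t * deriv q t) t := by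
      refine hF2.congr_of_eventuallyEq ?_
      have hev : ∀ᶠ s in 𝓝 t, ‖s‖ < δ := by
        have : ball (0 : ℂ) δ ∈ 𝓝 t := isOpen_ball.mem_nhds htball
        filter_upwards [this] with s hs
        rwa [mem_ball, dist_zero_right] at hs
      filter_upwards [hev] with s hs
      rw [hfq s hs, pow_two]
    rw [hF1.unique hF2']
    ring
  -- the slope of `φ` at `0` tends to `L w w` and to `2 q 0`
  have hslope := hφ'.tendsto_slope_zero
  simp only [zero_add, hφ0, sub_zero, smul_eq_mul] at hslope
  have hcont : ContinuousAt (fun t : ℂ => 2 * q t + t * deriv q t) 0 := by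
    have hq0 : ContinuousAt q 0 := (hqa 0 (mem_ball_self hδ)).continuousAt
    have hq1 : ContinuousAt (deriv q) 0 := (hqa.deriv 0 (mem_ball_self hδ)).continuousAt
    exact (continuousAt_const.mul hq0).add (continuousAt_id.mul hq1)
  have hlim2 : Tendsto (fun t : ℂ => t⁻¹ * φ t) (𝓝[≠] 0) (𝓝 (2 * q 0 + 0 * deriv q 0)) := by
    refine (hcont.tendsto.mono_left nhdsWithin_le_nhds).congr' ?_
    have hev : ∀ᶠ t in 𝓝[≠] (0 : ℂ), t ≠ 0 ∧ ‖t‖ < δ := by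
      have h1 : ∀ᶠ t in 𝓝[≠] (0 : ℂ), t ≠ 0 := self_mem_nhdsWithin
      have h2 : ∀ᶠ t in 𝓝[≠] (0 : ℂ), ‖t‖ < δ := by
        have : ball (0 : ℂ) δ ∈ 𝓝[≠] (0 : ℂ) := mem_nhdsWithin_of_mem_nhds (isOpen_ball.mem_nhds (mem_ball_self hδ))
        filter_upwards [this] with t ht
        rwa [mem_ball, dist_zero_right] at ht
      exact h1.and h2
    filter_upwards [hev] with t ht
    obtain ⟨ht0, htδ⟩ := ht
    rw [hφeq t htδ]
    have e1 : t⁻¹ * (2 * t * q t + t ^ 2 * deriv q t) = (t⁻¹ * t) * (2 * q t + t * deriv q t) := by ring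
    rw [e1, inv_mul_cancel₀ ht0, one_mul]
  rw [zero_mul, add_zero] at hlim2
  exact tendsto_nhds_unique hslope hlim2

/-- **Holomorphic Hadamard lemma, bilinear-form version, with the identification of the value at the centre.**
For `f` holomorphic on the polydisc `‖z‖ < r` of `Fin m → ℂ` with `f 0 = 0`, `df(0) = 0` and `d(df)(0) = L`, there
is a holomorphic map `R` into the symmetric bilinear forms with `f z = R z z z` on the polydisc and `L = 2 • R 0`.
[cite: Milnor1963, Lemma 2.1 and proof of Lemma 2.2] [cite: HirschDT1976, Ch. 6 §1, proof of Thm. 1.1 (p. 146)] -/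
theorem exists_bilinForm_eq {r : ℝ} (hr : 0 < r) {f : (Fin m → ℂ) → ℂ} (hf : DifferentiableOn ℂ f (ball 0 r))
    (h0 : f 0 = 0) (h1 : fderiv ℂ f 0 = 0) {L : (Fin m → ℂ) →L[ℂ] (Fin m → ℂ) →L[ℂ] ℂ}
    (h2 : HasFDerivAt (fderiv ℂ f) L 0) :
    ∃ R : (Fin m → ℂ) → ((Fin m → ℂ) →L[ℂ] (Fin m → ℂ) →L[ℂ] ℂ),
      DifferentiableOn ℂ R (ball 0 r) ∧ (∀ z u v, R z u v = R z v u) ∧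
      (∀ z ∈ ball (0 : Fin m → ℂ) r, f z = R z z z) ∧ ∀ u v, L u v = 2 * R 0 u v := by
  classical
  obtain ⟨h, hh, hfh⟩ := exists_eq_sum_mul_mul hr hf h0 h1
  -- the symmetrized bilinear form
  let Bf : Fin m → Fin m → ((Fin m → ℂ) →L[ℂ] (Fin m → ℂ) →L[ℂ] ℂ) := fun i j =>
    (ContinuousLinearMap.proj (R := ℂ) (φ := fun _ : Fin m => ℂ) i).smulRight
      (ContinuousLinearMap.proj (R := ℂ) (φ := fun _ : Fin m => ℂ) j)
  let R : (Fin m → ℂ) → ((Fin m → ℂ) →L[ℂ] (Fin m → ℂ) →L[ℂ] ℂ) := fun z =>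
    ∑ i, ∑ j, (2⁻¹ * (h i j z + h j i z)) • Bf i j
  have hRapply : ∀ z u v, R z u v = ∑ i, ∑ j, 2⁻¹ * (h i j z + h j i z) * (u i * v j) := by
    intro z u v
    simp only [R, Bf, FunLike.coe_sum, Finset.sum_apply, FunLike.coe_smul, Pi.smul_apply, coordForm_apply, smul_eq_mul]
  have hRsymm : ∀ z u v, R z u v = R z v u := by
    intro z u v
    rw [hRapply, hRapply, Finset.sum_comm]
    refine Finset.sum_congr rfl fun i _ => Finset.sum_congr rfl fun j _ => ?_
    ring
  -- the diagonal: `R z z z = Σ hᵢⱼ zᵢ zⱼ`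
  have hdiag : ∀ z w : Fin m → ℂ, R z w w = ∑ i, ∑ j, w i * w j * h i j z := by
    intro z w
    rw [hRapply]
    have hswap : ∑ i, ∑ j, h j i z * (w i * w j) = ∑ i, ∑ j, h i j z * (w i * w j) := by
      rw [Finset.sum_comm]
      exact Finset.sum_congr rfl fun i _ => Finset.sum_congr rfl fun j _ => by ring
    have : ∑ i, ∑ j, 2⁻¹ * (h i j z + h j i z) * (w i * w j) =
        2⁻¹ * (∑ i, ∑ j, h i j z * (w i * w j)) + 2⁻¹ * (∑ i, ∑ j, h j i z * (w i * w j)) := by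
      rw [Finset.mul_sum, Finset.mul_sum, ← Finset.sum_add_distrib]
      refine Finset.sum_congr rfl fun i _ => ?_
      rw [Finset.mul_sum, Finset.mul_sum, ← Finset.sum_add_distrib]
      refine Finset.sum_congr rfl fun j _ => ?_
      ring
    rw [this, hswap, ← add_mul]
    norm_num
    exact Finset.sum_congr rfl fun i _ => Finset.sum_congr rfl fun j _ => by ring
  refine ⟨R, ?_, hRsymm, fun z hz => by rw [hdiag, hfh z hz], ?_⟩
  · -- holomorphy
    refine DifferentiableOn.fun_sum fun i _ => DifferentiableOn.fun_sum fun j _ => ?_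
    exact (((hh i j).add (hh j i)).const_mul _).smul_const _
  · -- `L = 2 R 0`: along every complex line `f (t w) = t² q_w(t)` with `q_w(0) = R 0 w w`
    have hquad : ∀ w, L w w = 2 * R 0 w w := by
      intro w
      -- a radius for the line
      obtain ⟨δ, hδ, hδr⟩ : ∃ δ : ℝ, 0 < δ ∧ ∀ t : ℂ, ‖t‖ < δ → t • w ∈ ball (0 : Fin m → ℂ) r := by
        refine ⟨r / (‖w‖ + 1), by positivity, fun t ht => ?_⟩
        rw [mem_ball, dist_zero_right, norm_smul]
        have hw : 0 < ‖w‖ + 1 := by positivity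
        calc ‖t‖ * ‖w‖ ≤ ‖t‖ * (‖w‖ + 1) := by gcongr; linarith
          _ < r / (‖w‖ + 1) * (‖w‖ + 1) := by gcongr
          _ = r := div_mul_cancel₀ r hw.ne'
      set q : ℂ → ℂ := fun t => ∑ i, ∑ j, w i * w j * h i j (t • w) with hq
      have hqd : DifferentiableOn ℂ q (ball 0 δ) := by
        refine DifferentiableOn.fun_sum fun i _ => DifferentiableOn.fun_sum fun j _ => ?_
        refine (differentiableOn_const _).mul ?_
        refine (hh i j).comp ((differentiableOn_id).smul_const w) fun t ht => ?_
        rw [mem_ball, dist_zero_right] at ht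
        exact hδr t ht
      have hfq : ∀ t : ℂ, ‖t‖ < δ → f (t • w) = t ^ 2 * q t := by
        intro t ht
        rw [hfh _ (hδr t ht), hq]
        simp only [Finset.mul_sum, Pi.smul_apply, smul_eq_mul]
        exact Finset.sum_congr rfl fun i _ => Finset.sum_congr rfl fun j _ => by ring
      have hL := apply_apply_eq_two_mul hf h1 h2 w hδ hδr hqd hfq
      rw [hL, hq]
      simp only [zero_smul]
      rw [hdiag]
    -- polarization (both sides symmetric)
    have hball : ball (0 : Fin m → ℂ) r ∈ 𝓝 (0 : Fin m → ℂ) := isOpen_ball.mem_nhds (mem_ball_self hr)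
    have hLsymm : ∀ u v, L u v = L v u := by
      refine fun u v => second_derivative_symmetric_of_eventually (f := f) (f' := fderiv ℂ f) ?_ h2 u v
      filter_upwards [hball] with y hy
      exact (hf.differentiableAt (isOpen_ball.mem_nhds hy)).hasFDerivAt
    intro u v
    have huv := hquad (u + v)
    have hu := hquad u
    have hv := hquad v
    simp only [map_add, add_apply] at huv
    rw [hLsymm v u, hRsymm 0 v u] at huv
    linear_combination (2⁻¹ : ℂ) * huv - (2⁻¹ : ℂ) * hu - (2⁻¹ : ℂ) * hv

end Hadamard

/-! ### §3 The holomorphic Morse lemma at the origin -/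

section Origin

variable {m : ℕ}

/-- The sum-of-squares quadratic form on `Fin m → ℂ` is non-degenerate. [folklore] -/
private theorem separatingLeft_sumSq :
    (QuadraticMap.associated (R := ℂ) (QuadraticMap.weightedSumSquares ℂ (1 : Fin m → ℂ))).SeparatingLeft := by
  classical
  intro u hu
  funext k
  have h := hu (Pi.single k 1)
  rw [QuadraticMap.associated_apply] at h
  simp only [QuadraticMap.weightedSumSquares_apply, Pi.add_apply, Pi.one_apply, one_smul] at h
  have hsum : ∀ i : Fin m, (u i + (Pi.single k (1 : ℂ) : Fin m → ℂ) i) * (u i + (Pi.single k (1 : ℂ) : Fin m → ℂ) i)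
      = u i * u i + ((Pi.single k (1 : ℂ) : Fin m → ℂ) i * (Pi.single k (1 : ℂ) : Fin m → ℂ) i
        + 2 * (u i * (Pi.single k (1 : ℂ) : Fin m → ℂ) i)) := fun i => by ring
  simp_rw [hsum, Finset.sum_add_distrib, ← Finset.mul_sum] at h
  have h2 : ∑ i : Fin m, u i * (Pi.single k (1 : ℂ) : Fin m → ℂ) i = u k := by
    simp [Pi.single_apply]
  rw [h2] at h
  have h3 : (⅟ (2 : ℂ)) • (2 * u k) = 0 := by
    have e1 : ∑ x : Fin m, u x * u x + (∑ x : Fin m, (Pi.single k (1 : ℂ) : Fin m → ℂ) x *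
        (Pi.single k (1 : ℂ) : Fin m → ℂ) x + 2 * u k) - ∑ x : Fin m, u x * u x -
        ∑ x : Fin m, (Pi.single k (1 : ℂ) : Fin m → ℂ) x * (Pi.single k (1 : ℂ) : Fin m → ℂ) x = 2 * u k := by ring
    rw [e1] at h
    exact h
  rw [smul_eq_mul, ← mul_assoc, invOf_mul_self, one_mul] at h3
  simpa using h3

/-- **The holomorphic Morse lemma at the origin.**  Let `f` be holomorphic on the polydisc `‖z‖ < r` of `Fin m → ℂ`
with `f 0 = 0`, `df(0) = 0` and non-degenerate `d(df)(0) = L`.  Then there is an open partial homeomorphism `Θ` of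
`Fin m → ℂ` with `0 ∈ Θ.source ⊆ {‖z‖ < r}`, `Θ 0 = 0`, `Θ` complex differentiable and real `C^∞` on `Θ.source`,
`Θ.symm` real `C^∞` on `Θ.target`, and `f x = Σᵢ (Θ x)ᵢ²` on `Θ.source`.
[cite: Milnor1963, Lemma 2.2] [cite: HirschDT1976, Ch. 6 §1, Thm. 1.1] -/
theorem exists_holomorphicMorseChart_zero {r : ℝ} (hr : 0 < r) {f : (Fin m → ℂ) → ℂ}
    (hf : DifferentiableOn ℂ f (ball 0 r)) (h0 : f 0 = 0) (h1 : fderiv ℂ f 0 = 0)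
    {L : (Fin m → ℂ) →L[ℂ] (Fin m → ℂ) →L[ℂ] ℂ} (h2 : HasFDerivAt (fderiv ℂ f) L 0)
    (hL : ∀ u, (∀ v, L u v = 0) → u = 0) :
    ∃ Θ : OpenPartialHomeomorph (Fin m → ℂ) (Fin m → ℂ),
      (0 : Fin m → ℂ) ∈ Θ.source ∧ Θ 0 = 0 ∧ Θ.source ⊆ ball 0 r ∧
      DifferentiableOn ℂ Θ Θ.source ∧ ContDiffOn ℝ ∞ Θ Θ.source ∧ ContDiffOn ℝ ∞ Θ.symm Θ.target ∧
      ∀ x ∈ Θ.source, f x = ∑ i, (Θ x i) ^ 2 := by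
  classical
  obtain ⟨R, hRd, hRsymm, hfR, hLR⟩ := exists_bilinForm_eq hr hf h0 h1 h2
  set H₀ := R 0 with hH₀
  have hH₀symm : ∀ u v, H₀ u v = H₀ v u := hRsymm 0
  have hH₀nd : ∀ u, (∀ v, H₀ u v = 0) → u = 0 := by
    intro u hu
    refine hL u fun v => ?_
    rw [hLR, hu v, mul_zero]
  obtain ⟨N, P, hNo, hH₀N, hPs, hPH₀, hPid⟩ := exists_contDiffOn_bilinearComp_eq H₀ hH₀symm hH₀nd
  -- the domain `U₁ = ball ∩ R⁻¹ N` and the map `θ x = P (R x) x`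
  set U₁ : Set (Fin m → ℂ) := ball 0 r ∩ R ⁻¹' N with hU₁
  have hU₁o : IsOpen U₁ := (hRd.continuousOn.isOpen_inter_preimage isOpen_ball hNo)
  have h0U₁ : (0 : Fin m → ℂ) ∈ U₁ := ⟨mem_ball_self hr, by rw [mem_preimage, ← hH₀]; exact hH₀N⟩
  set θ : (Fin m → ℂ) → (Fin m → ℂ) := fun x => P (R x) x with hθ
  have hPRd : DifferentiableOn ℂ (fun x => P (R x)) U₁ :=
    (hPs.differentiableOn (by simp)).comp (hRd.mono inter_subset_left) fun x hx => hx.2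
  have hθd : DifferentiableOn ℂ θ U₁ := hPRd.clm_apply differentiableOn_id
  have hθ0 : θ 0 = 0 := by simp [hθ]
  have hθderiv : HasFDerivAt θ ((ContinuousLinearEquiv.refl ℂ (Fin m → ℂ) : (Fin m → ℂ) ≃L[ℂ] (Fin m → ℂ)) :
      (Fin m → ℂ) →L[ℂ] (Fin m → ℂ)) 0 := by
    have hc : HasFDerivAt (fun x => P (R x)) (fderiv ℂ (fun x => P (R x)) 0) 0 :=
      (hPRd.differentiableAt (hU₁o.mem_nhds h0U₁)).hasFDerivAt
    have h := hc.clm_apply (hasFDerivAt_id (0 : Fin m → ℂ))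
    refine h.congr_fderiv ?_
    ext v i
    simp [← hH₀, hPH₀]
  have hθcd : ContDiffOn ℂ ∞ θ U₁ :=
    ((Literature.Analysis.Complex.SCV.analyticOnNhd_of_differentiableOn hθd hU₁o).contDiffOn_of_completeSpace)
  obtain ⟨G, hGθ, h0G, hGU₁, hGcd, hGsymm, -⟩ :=
    exists_openPartialHomeomorph_contDiffOn_symm hU₁o h0U₁ (m := ∞) (by simp) hθcd _ hθderiv
  -- `f = H₀ (θ ·) (θ ·)` on `U₁`
  have hfθ : ∀ x ∈ U₁, f x = H₀ (θ x) (θ x) := by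
    intro x hx
    rw [hfR x hx.1, hθ]
    exact (hPid (R x) hx.2 (hRsymm x) x x).symm
  -- the linear isometry `H₀ ≅ Σ zᵢ²`
  let B₀ : LinearMap.BilinForm ℂ (Fin m → ℂ) := (ContinuousLinearMap.coeLM ℂ).comp (H₀ : (Fin m → ℂ) →ₗ[ℂ] ((Fin m → ℂ) →L[ℂ] ℂ))
  have hB₀ : ∀ u v, B₀ u v = H₀ u v := fun u v => rfl
  let Q₁ : QuadraticForm ℂ (Fin m → ℂ) := B₀.toQuadraticMap
  have hQ₁ : ∀ u, Q₁ u = H₀ u u := fun u => rfl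
  have hQ₁nd : (QuadraticMap.associated (R := ℂ) Q₁).SeparatingLeft := by
    have hassoc : QuadraticMap.associated (R := ℂ) Q₁ = B₀ :=
      QuadraticMap.associated_left_inverse (S := ℂ) (B₁ := B₀) (fun u v => by rw [hB₀, hB₀, hH₀symm])
    rw [hassoc]
    intro u hu
    exact hH₀nd u fun v => by rw [← hB₀]; exact hu v
  obtain ⟨eQ⟩ := QuadraticForm.equivalent_of_isAlgClosed Q₁ (QuadraticMap.weightedSumSquares ℂ (1 : Fin m → ℂ)) hQ₁nd
    separatingLeft_sumSq
  have heQ : ∀ u : Fin m → ℂ, ∑ i, (eQ u i) ^ 2 = H₀ u u := by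
    intro u
    have h := eQ.map_app u
    rw [QuadraticMap.weightedSumSquares_apply] at h
    rw [← hQ₁, ← h]
    exact Finset.sum_congr rfl fun i _ => by simp [sq]
  let eC : (Fin m → ℂ) ≃L[ℂ] (Fin m → ℂ) := eQ.toLinearEquiv.toContinuousLinearEquiv
  have heC : ∀ u, eC u = eQ u := fun u => rfl
  -- the chart
  refine ⟨G.transHomeomorph eC.toHomeomorph, ?_, ?_, ?_, ?_, ?_, ?_, ?_⟩
  · simpa using h0G
  · show eC (G 0) = 0
    rw [hGθ, hθ0, map_zero]
  · intro x hx
    exact (hGU₁ (by simpa using hx)).1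
  · have : DifferentiableOn ℂ (⇑eC ∘ ⇑G) G.source := eC.differentiable.comp_differentiableOn (hGθ ▸ hθd.mono hGU₁)
    simpa [OpenPartialHomeomorph.transHomeomorph] using this
  · have : ContDiffOn ℂ ∞ (⇑eC ∘ ⇑G) G.source := eC.contDiff.comp_contDiffOn hGcd
    simpa [OpenPartialHomeomorph.transHomeomorph] using this.restrict_scalars ℝ
  · have htgt : (G.transHomeomorph eC.toHomeomorph).target = eC.toHomeomorph.symm ⁻¹' G.target := by
      simp [OpenPartialHomeomorph.transHomeomorph]
    have hsymm : ∀ z, (G.transHomeomorph eC.toHomeomorph).symm z = G.symm (eC.symm z) := fun z => rfl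
    rw [htgt]
    have h : ContDiffOn ℂ ∞ (fun z => G.symm (eC.symm z)) (eC.toHomeomorph.symm ⁻¹' G.target) :=
      hGsymm.comp eC.symm.contDiff.contDiffOn fun z hz => hz
    exact (h.restrict_scalars ℝ).congr fun z _ => hsymm z
  · intro x hx
    have hx' : x ∈ G.source := by simpa using hx
    show f x = ∑ i, (eC (G x) i) ^ 2
    rw [heC, heQ, hGθ]
    exact hfθ x (hGU₁ hx')

end Origin

/-! ### §4 The holomorphic Morse lemma at a non-degenerate critical point -/

section General

variable {m : ℕ}

/-- **The holomorphic Morse lemma** (Milnor, *Morse theory*, Lemma 2.2, complex version; AGZV I §6.1).  Let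
`f : (Fin m → ℂ) → ℂ` be complex differentiable on an open set `U ∋ p` with `df(p) = 0` and non-degenerate second
derivative `d(df)(p) = L` (`∀ u, (∀ v, L u v = 0) → u = 0`).  Then there is an open partial homeomorphism `Θ` of
`Fin m → ℂ` with `p ∈ Θ.source ⊆ U`, `Θ p = 0`, `Θ` complex differentiable and real `C^∞` on `Θ.source`, `Θ.symm`
real `C^∞` on `Θ.target`, and `f x = f p + Σᵢ (Θ x)ᵢ²` for all `x ∈ Θ.source` — the output format of
`PhamBrieskorn.exists_cyclicNodePencil_morseChart`. [cite: Milnor1963, Lemma 2.2]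
[cite: ArnoldGuseinZadeVarchenko1985, §6.1] [cite: HirschDT1976, Ch. 6 §1, Thm. 1.1] -/
theorem exists_holomorphicMorseChart {f : (Fin m → ℂ) → ℂ} {U : Set (Fin m → ℂ)} (hU : IsOpen U)
    (hf : DifferentiableOn ℂ f U) {p : Fin m → ℂ} (hp : p ∈ U) (h1 : fderiv ℂ f p = 0)
    {L : (Fin m → ℂ) →L[ℂ] (Fin m → ℂ) →L[ℂ] ℂ} (h2 : HasFDerivAt (fderiv ℂ f) L p)
    (hL : ∀ u, (∀ v, L u v = 0) → u = 0) :
    ∃ Θ : OpenPartialHomeomorph (Fin m → ℂ) (Fin m → ℂ),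
      p ∈ Θ.source ∧ Θ p = 0 ∧ Θ.source ⊆ U ∧
      DifferentiableOn ℂ Θ Θ.source ∧ ContDiffOn ℝ ∞ Θ Θ.source ∧ ContDiffOn ℝ ∞ Θ.symm Θ.target ∧
      ∀ x ∈ Θ.source, f x = f p + ∑ i, (Θ x i) ^ 2 := by
  -- a polydisc `ball p r ⊆ U` and the translated function `g y = f (p + y) - f p`
  obtain ⟨r, hr, hrU⟩ := Metric.isOpen_iff.1 hU p hp
  set g : (Fin m → ℂ) → ℂ := fun y => f (p + y) - f p with hg
  have hτ : ∀ y ∈ ball (0 : Fin m → ℂ) r, p + y ∈ ball p r := fun y hy => by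
    rw [mem_ball, dist_eq_norm, add_sub_cancel_left]; rwa [mem_ball, dist_zero_right] at hy
  have hτd : ∀ y : Fin m → ℂ, HasFDerivAt (fun y : Fin m → ℂ => p + y) (ContinuousLinearMap.id ℂ _) y :=
    fun y => (hasFDerivAt_id y).const_add p
  have hgd' : ∀ y ∈ ball (0 : Fin m → ℂ) r, HasFDerivAt g (fderiv ℂ f (p + y)) y := by
    intro y hy
    have hfd : HasFDerivAt f (fderiv ℂ f (p + y)) (p + y) :=
      (hf.differentiableAt (hU.mem_nhds (hrU (hτ y hy)))).hasFDerivAt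
    have h := (hfd.comp y (hτd y)).sub_const (f p)
    rw [ContinuousLinearMap.comp_id] at h
    exact h
  have hgd : DifferentiableOn ℂ g (ball 0 r) := fun y hy => (hgd' y hy).differentiableAt.differentiableWithinAt
  have hg0 : g 0 = 0 := by simp [hg]
  have hg1 : fderiv ℂ g 0 = 0 := by rw [(hgd' 0 (mem_ball_self hr)).fderiv, add_zero, h1]
  have hg2 : HasFDerivAt (fderiv ℂ g) L 0 := by
    have hev : fderiv ℂ g =ᶠ[𝓝 0] fun y => fderiv ℂ f (p + y) := by
      filter_upwards [isOpen_ball.mem_nhds (mem_ball_self hr)] with y hy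
      exact (hgd' y hy).fderiv
    rw [hev.hasFDerivAt_iff]
    have h2' : HasFDerivAt (fderiv ℂ f) L (p + 0) := by rwa [add_zero]
    have h := h2'.comp (0 : Fin m → ℂ) (hτd 0)
    rwa [ContinuousLinearMap.comp_id] at h
  obtain ⟨Θ₀, h0Θ, hΘ0, hΘball, hΘd, hΘcd, hΘsymm, hΘf⟩ := exists_holomorphicMorseChart_zero hr hgd hg0 hg1 hg2 hL
  -- translate: `Θ x = Θ₀ (x - p)`
  set τ : (Fin m → ℂ) ≃ₜ (Fin m → ℂ) := Homeomorph.subRight p with hτdef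
  have hτapply : ∀ x, τ x = x - p := fun x => rfl
  refine ⟨τ.transOpenPartialHomeomorph Θ₀, ?_, ?_, ?_, ?_, ?_, ?_, ?_⟩
  · show τ p ∈ Θ₀.source
    rw [hτapply, sub_self]; exact h0Θ
  · show Θ₀ (τ p) = 0
    rw [hτapply, sub_self]; exact hΘ0
  · intro x hx
    have hx' : x - p ∈ Θ₀.source := by simpa [hτapply] using hx
    have := hrU (hτ (x - p) (hΘball hx'))
    simpa using this
  · have hsrc : (τ.transOpenPartialHomeomorph Θ₀).source = τ ⁻¹' Θ₀.source := rfl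
    rw [hsrc]
    have h : DifferentiableOn ℂ (fun x => Θ₀ (x - p)) (τ ⁻¹' Θ₀.source) :=
      hΘd.comp (differentiableOn_id.sub_const p) fun x hx => by simpa [hτapply] using hx
    exact h.congr fun x _ => by simp [hτapply]
  · have hsrc : (τ.transOpenPartialHomeomorph Θ₀).source = τ ⁻¹' Θ₀.source := rfl
    rw [hsrc]
    have h : ContDiffOn ℝ ∞ (fun x => Θ₀ (x - p)) (τ ⁻¹' Θ₀.source) :=
      hΘcd.comp (contDiffOn_id.sub contDiffOn_const) fun x hx => by simpa [hτapply] using hx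
    exact h.congr fun x _ => by simp [hτapply]
  · have htgt : (τ.transOpenPartialHomeomorph Θ₀).target = Θ₀.target := rfl
    rw [htgt]
    have h : ContDiffOn ℝ ∞ (fun z => Θ₀.symm z + p) Θ₀.target := hΘsymm.add contDiffOn_const
    exact h.congr fun z _ => rfl
  · intro x hx
    have hx' : x - p ∈ Θ₀.source := by simpa [hτapply] using hx
    have h := hΘf (x - p) hx'
    simp only [hg, add_sub_cancel] at h
    show f x = f p + ∑ i, (Θ₀ (τ x) i) ^ 2
    rw [hτapply, ← h]
    ring

end General

end HolomorphicMorse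

end Literature.Geometry.ComplexAnalytic

end
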